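import Summits.Ventures.CertifiedManyBodySolver.Observables.SourcedGibbsTrialCapSpinTrial
import Summits.Ventures.CertifiedManyBodySolver.Observables.SourcedGibbsTrialCapAFSymbol
import Summits.Ventures.CertifiedManyBodySolver.Observables.SourcedGibbsTrialCapSqPair
import Summits.Ventures.CertifiedManyBodySolver.Observables.SourcedGibbsTrialCapAFSpectrum
import HarnessLib

/-!
# The HF–BCS sourced cap in momentum space (XIII-b): the Fermi matrix of the antiferromagnetic + `d`-wave-pinned torus
# on plane waves (both Nambu sheets), in closed form

HONEST FRAMING: zero compute; a PROVED finite-volume identity about the Fermi matrix `F = (1 + e^{β𝓗})⁻¹` of the Nambu matrix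
`𝓗 = 𝓗_{2k,μ',h} + diag(M·(−1)^x)` of the spin-density-wave + `d`-wave-pinned quasi-free TRIAL Hamiltonian (files (VIII), (X));
no number is claimed; the staggered field is a variational device; not a statement about order; not a superconductivity verdict.

Cell `hubbard-obs` (D-0042 / D-0082), seat `hubbard-obs-pin-2` (`prover-hubbard-obs-pin-2-g7-0`). With `ε = ε_{2k}(p)`,
`ξ = ε − μ'`, `G = 2√2·h·ĝ_d(p)`, `R = √(ε² + M²)`, `E_± = √((R ± |μ'|)² + G²)`, `Q_± = tanh(βE_±/2)/(2E_±)`, `κ = μ'/(2|μ'|R)`: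

* `afNambu_sq_pair_zero` — the square-closed pair `(χ_p⊗e_↑, χ_{p+Q}⊗e_↑)`: `𝓗²χ_p⊗e_↑ = a χ_p⊗e_↑ + b χ_{p+Q}⊗e_↑`,
  `𝓗²χ_{p+Q}⊗e_↑ = b χ_p⊗e_↑ + a' χ_{p+Q}⊗e_↑`, `a = ξ² + G² + M²`, `a' = (−ε−μ')² + G² + M²`, `b = −2μ'M` (file (X) + the Néel flips).
* `fermi_afNambu_mulVec_planeWave_zero` — **`F(χ_p ⊗ e_↑) = c₀₀ χ_p⊗e_↑ + c₁₀ χ_p⊗e_↓ + c_Q₀ χ_{p+Q}⊗e_↑ + c_Q₁ χ_{p+Q}⊗e_↓`** with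
  `c₀₀ = ½ − Q₊(ξ/2 − κ(ε² + M² − εμ')) − Q₋(ξ/2 + κ(ε² + M² − εμ'))`, `c₁₀ = −G(Q₊(½ − κε) + Q₋(½ + κε))`,
  `c_Q₀ = −M(Q₊(½ + κμ') + Q₋(½ − κμ'))`, `c_Q₁ = −κMG(Q₊ − Q₋)` (file (XI) on the pair, eigenvalues by file (XIII-a)); at
  `M = 0` this is the paramagnetic symbol `½ − q_kξ_k`, `−q_kg_k` of `fermiMatrix_dWaveNambu_apply`.
* `afNambu_sq_mulVec_planeWave_neel_one`, `fermi_afNambu_mulVec_planeWave_one` — the same on the HOLE sheet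
  (`b = +2μ'M`): `F(χ_p ⊗ e_↓) = d₀₁ χ_p⊗e_↑ + d₁₁ χ_p⊗e_↓ + d_Q₀ χ_{p+Q}⊗e_↑ + d_Q₁ χ_{p+Q}⊗e_↓`.

References: Bach–Lieb–Solovej, J. Stat. Phys. 76 (1994) 3, §2 [BachLiebSolovej1994]; J. E. Hirsch, Phys. Rev. B 31 (1985) 4403
[HirschPRB1985]; von Delft–Ralph, Phys. Rep. 345 (2001) 61, §4.2 [VondelftRalph2001].
-/

noncomputable section

open Matrix Finset Literature.MathematicalPhysics.QuantumLattice Literature.Probability.LatticeModels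
open scoped ComplexConjugate

namespace Summit.Ventures.CertifiedManyBodySolver.Observables

section AFFermi

variable (k : ℕ) [NeZero (2 * k)]

/-- **The square-closed pair on the particle sheet**: `𝓗²(χ_{p+Q}⊗e_↑) = (−2μ'M)·χ_p⊗e_↑ + ((−ε−μ')² + G² + M²)·χ_{p+Q}⊗e_↑`
(file (X) at `p + Q`, with `ε_{p+Q} = −ε_p`, `ĝ_d(p+Q) = −ĝ_d(p)`, `p + Q + Q = p`). [cite: HirschPRB1985] -/
theorem afNambu_sq_mulVec_planeWave_neel_zero (hL : 3 ≤ 2 * k) (μ' h M : ℝ) (p : TorusSite 2 (2 * k)) :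
    (bdgNambuMatrix
        (fun x y => if (fermionTorusGraph 2 (2 * k)).Adj x y then -(1 : ℂ) else 0)
        (fun u v : FermionTorus 2 (2 * k) => -(h : ℂ) * ∑ i : Fin 2,
          if v = FermionTorus.ofTorusSite (u.toTorusSite + Pi.single i 1) then
            ((Real.sqrt 2 * (if i = 0 then 1 else -1) : ℝ) : ℂ) else 0) μ' +
      diagonal fun i : Orb (FermionTorus 2 (2 * k)) => ((M * neelSign ((ofLex i).1.toTorusSite) : ℝ) : ℂ)) *ᵥ
      ((bdgNambuMatrix
        (fun x y => if (fermionTorusGraph 2 (2 * k)).Adj x y then -(1 : ℂ) else 0)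
        (fun u v : FermionTorus 2 (2 * k) => -(h : ℂ) * ∑ i : Fin 2,
          if v = FermionTorus.ofTorusSite (u.toTorusSite + Pi.single i 1) then
            ((Real.sqrt 2 * (if i = 0 then 1 else -1) : ℝ) : ℂ) else 0) μ' +
      diagonal fun i : Orb (FermionTorus 2 (2 * k)) => ((M * neelSign ((ofLex i).1.toTorusSite) : ℝ) : ℂ)) *ᵥ
        planeWave (p + neelIndex (2 * k)) 0) =
      ((-(2 * μ' * M) : ℝ) : ℂ) • planeWave p 0 +
        (((-torusBand (2 * k) p - μ') ^ 2 + (2 * Real.sqrt 2 * h * dWaveGap p) ^ 2 + M ^ 2 : ℝ) : ℂ) •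
          planeWave (p + neelIndex (2 * k)) 0 := by
  rw [afNambu_sq_mulVec_planeWave_zero k hL μ' h M (p + neelIndex (2 * k)), torusBand_add_neelIndex,
    dWaveGap_add_neelIndex, add_neelIndex_add_neelIndex, add_comm]
  congr 2
  push_cast
  ring

/-- **The Fermi matrix of the antiferromagnetic + `d`-wave-pinned torus on a plane wave, particle sheet** (`2k ≥ 3`):
`(1 + e^{β𝓗})⁻¹ (χ_p ⊗ e_↑) = c₀₀ χ_p⊗e_↑ + c₁₀ χ_p⊗e_↓ + c_Q₀ χ_{p+Q}⊗e_↑ + c_Q₁ χ_{p+Q}⊗e_↓` with the closed-form real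
coefficients of the docstring (`E_± = √((√(ε²+M²) ± |μ'|)² + G²)`). [cite: BachLiebSolovej1994, §2] [cite: HirschPRB1985] [cite: VondelftRalph2001, §4.2] -/
theorem fermi_afNambu_mulVec_planeWave_zero (hL : 3 ≤ 2 * k) (μ' h M β : ℝ) (p : TorusSite 2 (2 * k)) :
    (1 + NormedSpace.exp ((β : ℂ) • (bdgNambuMatrix
        (fun x y => if (fermionTorusGraph 2 (2 * k)).Adj x y then -(1 : ℂ) else 0)
        (fun u v : FermionTorus 2 (2 * k) => -(h : ℂ) * ∑ i : Fin 2,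
          if v = FermionTorus.ofTorusSite (u.toTorusSite + Pi.single i 1) then
            ((Real.sqrt 2 * (if i = 0 then 1 else -1) : ℝ) : ℂ) else 0) μ' +
      diagonal fun i : Orb (FermionTorus 2 (2 * k)) => ((M * neelSign ((ofLex i).1.toTorusSite) : ℝ) : ℂ))))⁻¹ *ᵥ
        planeWave p 0 =
      ((1 / 2 -
          Real.tanh (β * Real.sqrt ((Real.sqrt (torusBand (2 * k) p ^ 2 + M ^ 2) + |μ'|) ^ 2 + (2 * Real.sqrt 2 * h * dWaveGap p) ^ 2) / 2) /
              (2 * Real.sqrt ((Real.sqrt (torusBand (2 * k) p ^ 2 + M ^ 2) + |μ'|) ^ 2 + (2 * Real.sqrt 2 * h * dWaveGap p) ^ 2)) *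
            ((torusBand (2 * k) p - μ') / 2 - μ' / (2 * |μ'| * Real.sqrt (torusBand (2 * k) p ^ 2 + M ^ 2)) *
              (torusBand (2 * k) p ^ 2 + M ^ 2 - torusBand (2 * k) p * μ')) -
          Real.tanh (β * Real.sqrt ((Real.sqrt (torusBand (2 * k) p ^ 2 + M ^ 2) - |μ'|) ^ 2 + (2 * Real.sqrt 2 * h * dWaveGap p) ^ 2) / 2) /
              (2 * Real.sqrt ((Real.sqrt (torusBand (2 * k) p ^ 2 + M ^ 2) - |μ'|) ^ 2 + (2 * Real.sqrt 2 * h * dWaveGap p) ^ 2)) *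
            ((torusBand (2 * k) p - μ') / 2 + μ' / (2 * |μ'| * Real.sqrt (torusBand (2 * k) p ^ 2 + M ^ 2)) *
              (torusBand (2 * k) p ^ 2 + M ^ 2 - torusBand (2 * k) p * μ')) : ℝ) : ℂ) • planeWave p 0 +
      ((-(2 * Real.sqrt 2 * h * dWaveGap p) *
          (Real.tanh (β * Real.sqrt ((Real.sqrt (torusBand (2 * k) p ^ 2 + M ^ 2) + |μ'|) ^ 2 + (2 * Real.sqrt 2 * h * dWaveGap p) ^ 2) / 2) /
              (2 * Real.sqrt ((Real.sqrt (torusBand (2 * k) p ^ 2 + M ^ 2) + |μ'|) ^ 2 + (2 * Real.sqrt 2 * h * dWaveGap p) ^ 2)) *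
            (1 / 2 - μ' / (2 * |μ'| * Real.sqrt (torusBand (2 * k) p ^ 2 + M ^ 2)) * torusBand (2 * k) p) +
          Real.tanh (β * Real.sqrt ((Real.sqrt (torusBand (2 * k) p ^ 2 + M ^ 2) - |μ'|) ^ 2 + (2 * Real.sqrt 2 * h * dWaveGap p) ^ 2) / 2) /
              (2 * Real.sqrt ((Real.sqrt (torusBand (2 * k) p ^ 2 + M ^ 2) - |μ'|) ^ 2 + (2 * Real.sqrt 2 * h * dWaveGap p) ^ 2)) *
            (1 / 2 + μ' / (2 * |μ'| * Real.sqrt (torusBand (2 * k) p ^ 2 + M ^ 2)) * torusBand (2 * k) p)) : ℝ) : ℂ) •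
        planeWave p 1 +
      ((-M *
          (Real.tanh (β * Real.sqrt ((Real.sqrt (torusBand (2 * k) p ^ 2 + M ^ 2) + |μ'|) ^ 2 + (2 * Real.sqrt 2 * h * dWaveGap p) ^ 2) / 2) /
              (2 * Real.sqrt ((Real.sqrt (torusBand (2 * k) p ^ 2 + M ^ 2) + |μ'|) ^ 2 + (2 * Real.sqrt 2 * h * dWaveGap p) ^ 2)) *
            (1 / 2 + μ' / (2 * |μ'| * Real.sqrt (torusBand (2 * k) p ^ 2 + M ^ 2)) * μ') +
          Real.tanh (β * Real.sqrt ((Real.sqrt (torusBand (2 * k) p ^ 2 + M ^ 2) - |μ'|) ^ 2 + (2 * Real.sqrt 2 * h * dWaveGap p) ^ 2) / 2) /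
              (2 * Real.sqrt ((Real.sqrt (torusBand (2 * k) p ^ 2 + M ^ 2) - |μ'|) ^ 2 + (2 * Real.sqrt 2 * h * dWaveGap p) ^ 2)) *
            (1 / 2 - μ' / (2 * |μ'| * Real.sqrt (torusBand (2 * k) p ^ 2 + M ^ 2)) * μ')) : ℝ) : ℂ) •
        planeWave (p + neelIndex (2 * k)) 0 +
      ((-(μ' / (2 * |μ'| * Real.sqrt (torusBand (2 * k) p ^ 2 + M ^ 2)) * M * (2 * Real.sqrt 2 * h * dWaveGap p)) *
          (Real.tanh (β * Real.sqrt ((Real.sqrt (torusBand (2 * k) p ^ 2 + M ^ 2) + |μ'|) ^ 2 + (2 * Real.sqrt 2 * h * dWaveGap p) ^ 2) / 2) /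
              (2 * Real.sqrt ((Real.sqrt (torusBand (2 * k) p ^ 2 + M ^ 2) + |μ'|) ^ 2 + (2 * Real.sqrt 2 * h * dWaveGap p) ^ 2)) -
            Real.tanh (β * Real.sqrt ((Real.sqrt (torusBand (2 * k) p ^ 2 + M ^ 2) - |μ'|) ^ 2 + (2 * Real.sqrt 2 * h * dWaveGap p) ^ 2) / 2) /
              (2 * Real.sqrt ((Real.sqrt (torusBand (2 * k) p ^ 2 + M ^ 2) - |μ'|) ^ 2 + (2 * Real.sqrt 2 * h * dWaveGap p) ^ 2))) : ℝ) : ℂ) •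
        planeWave (p + neelIndex (2 * k)) 1 := by
  have hHerm := isHermitian_dWaveNambu_add_spinField (2 * k) μ' h (fun x => M * neelSign x.toTorusSite)
  -- the square-closed pair
  have hv := afNambu_sq_mulVec_planeWave_zero k hL μ' h M p
  have hw := afNambu_sq_mulVec_planeWave_neel_zero k hL μ' h M p
  have key := fermi_mulVec_of_sq_pair hHerm β hv hw
    (af_sq_block_sum_nonneg (torusBand (2 * k) p) μ' (2 * Real.sqrt 2 * h * dWaveGap p) M)
    (af_sq_block_det_nonneg (torusBand (2 * k) p) μ' (2 * Real.sqrt 2 * h * dWaveGap p) M)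
  rw [af_sq_block_eigen_plus, af_sq_block_eigen_minus, af_sq_block_sqrt_disc, af_sq_block_mean] at key
  rw [key]
  -- expand `𝓗 v±` with the symbol lemmas
  rw [hv]
  simp only [Matrix.mulVec_add, Matrix.mulVec_sub, Matrix.mulVec_smul,
    afNambu_mulVec_planeWave_zero k hL μ' h M p, afNambu_mulVec_planeWave_zero k hL μ' h M (p + neelIndex (2 * k)),
    torusBand_add_neelIndex, dWaveGap_add_neelIndex, add_neelIndex_add_neelIndex]
  ext o
  simp only [Pi.add_apply, Pi.sub_apply, Pi.smul_apply, smul_eq_mul]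
  push_cast
  ring

/-- **The square-closed pair on the hole sheet**: `𝓗²(χ_{p+Q}⊗e_↓) = (2μ'M)·χ_p⊗e_↓ + ((−ε−μ')² + G² + M²)·χ_{p+Q}⊗e_↓`.
[cite: HirschPRB1985] -/
theorem afNambu_sq_mulVec_planeWave_neel_one (hL : 3 ≤ 2 * k) (μ' h M : ℝ) (p : TorusSite 2 (2 * k)) :
    (bdgNambuMatrix
        (fun x y => if (fermionTorusGraph 2 (2 * k)).Adj x y then -(1 : ℂ) else 0)
        (fun u v : FermionTorus 2 (2 * k) => -(h : ℂ) * ∑ i : Fin 2,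
          if v = FermionTorus.ofTorusSite (u.toTorusSite + Pi.single i 1) then
            ((Real.sqrt 2 * (if i = 0 then 1 else -1) : ℝ) : ℂ) else 0) μ' +
      diagonal fun i : Orb (FermionTorus 2 (2 * k)) => ((M * neelSign ((ofLex i).1.toTorusSite) : ℝ) : ℂ)) *ᵥ
      ((bdgNambuMatrix
        (fun x y => if (fermionTorusGraph 2 (2 * k)).Adj x y then -(1 : ℂ) else 0)
        (fun u v : FermionTorus 2 (2 * k) => -(h : ℂ) * ∑ i : Fin 2,
          if v = FermionTorus.ofTorusSite (u.toTorusSite + Pi.single i 1) then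
            ((Real.sqrt 2 * (if i = 0 then 1 else -1) : ℝ) : ℂ) else 0) μ' +
      diagonal fun i : Orb (FermionTorus 2 (2 * k)) => ((M * neelSign ((ofLex i).1.toTorusSite) : ℝ) : ℂ)) *ᵥ
        planeWave (p + neelIndex (2 * k)) 1) =
      ((2 * μ' * M : ℝ) : ℂ) • planeWave p 1 +
        (((-torusBand (2 * k) p - μ') ^ 2 + (2 * Real.sqrt 2 * h * dWaveGap p) ^ 2 + M ^ 2 : ℝ) : ℂ) •
          planeWave (p + neelIndex (2 * k)) 1 := by
  rw [afNambu_sq_mulVec_planeWave_one k hL μ' h M (p + neelIndex (2 * k)), torusBand_add_neelIndex,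
    dWaveGap_add_neelIndex, add_neelIndex_add_neelIndex, add_comm]
  congr 2
  push_cast
  ring

/-- **The Fermi matrix of the antiferromagnetic + `d`-wave-pinned torus on a plane wave, HOLE sheet** (`2k ≥ 3`):
`(1 + e^{β𝓗})⁻¹ (χ_p ⊗ e_↓) = d₀₁ χ_p⊗e_↑ + d₁₁ χ_p⊗e_↓ + d_Q₀ χ_{p+Q}⊗e_↑ + d_Q₁ χ_{p+Q}⊗e_↓` with
`d₀₁ = −G(Q₊(½ − κε) + Q₋(½ + κε))`, `d₁₁ = ½ + Q₊(ξ/2 − κ(ε²+M²−εμ')) + Q₋(ξ/2 + κ(ε²+M²−εμ'))`,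
`d_Q₀ = κMG(Q₊ − Q₋)`, `d_Q₁ = −M(Q₊(½ + κμ') + Q₋(½ − κμ'))`; at `M = 0` this is the paramagnetic `−q_k g_k`, `½ + q_k ξ_k`.
[cite: BachLiebSolovej1994, §2] [cite: HirschPRB1985] [cite: VondelftRalph2001, §4.2] -/
theorem fermi_afNambu_mulVec_planeWave_one (hL : 3 ≤ 2 * k) (μ' h M β : ℝ) (p : TorusSite 2 (2 * k)) :
    (1 + NormedSpace.exp ((β : ℂ) • (bdgNambuMatrix
        (fun x y => if (fermionTorusGraph 2 (2 * k)).Adj x y then -(1 : ℂ) else 0)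
        (fun u v : FermionTorus 2 (2 * k) => -(h : ℂ) * ∑ i : Fin 2,
          if v = FermionTorus.ofTorusSite (u.toTorusSite + Pi.single i 1) then
            ((Real.sqrt 2 * (if i = 0 then 1 else -1) : ℝ) : ℂ) else 0) μ' +
      diagonal fun i : Orb (FermionTorus 2 (2 * k)) => ((M * neelSign ((ofLex i).1.toTorusSite) : ℝ) : ℂ))))⁻¹ *ᵥ
        planeWave p 1 =
      ((-(2 * Real.sqrt 2 * h * dWaveGap p) *
          (Real.tanh (β * Real.sqrt ((Real.sqrt (torusBand (2 * k) p ^ 2 + M ^ 2) + |μ'|) ^ 2 + (2 * Real.sqrt 2 * h * dWaveGap p) ^ 2) / 2) /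
              (2 * Real.sqrt ((Real.sqrt (torusBand (2 * k) p ^ 2 + M ^ 2) + |μ'|) ^ 2 + (2 * Real.sqrt 2 * h * dWaveGap p) ^ 2)) *
            (1 / 2 - μ' / (2 * |μ'| * Real.sqrt (torusBand (2 * k) p ^ 2 + M ^ 2)) * torusBand (2 * k) p) +
          Real.tanh (β * Real.sqrt ((Real.sqrt (torusBand (2 * k) p ^ 2 + M ^ 2) - |μ'|) ^ 2 + (2 * Real.sqrt 2 * h * dWaveGap p) ^ 2) / 2) /
              (2 * Real.sqrt ((Real.sqrt (torusBand (2 * k) p ^ 2 + M ^ 2) - |μ'|) ^ 2 + (2 * Real.sqrt 2 * h * dWaveGap p) ^ 2)) *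
            (1 / 2 + μ' / (2 * |μ'| * Real.sqrt (torusBand (2 * k) p ^ 2 + M ^ 2)) * torusBand (2 * k) p)) : ℝ) : ℂ) • planeWave p 0 +
      ((1 / 2 +
          Real.tanh (β * Real.sqrt ((Real.sqrt (torusBand (2 * k) p ^ 2 + M ^ 2) + |μ'|) ^ 2 + (2 * Real.sqrt 2 * h * dWaveGap p) ^ 2) / 2) /
              (2 * Real.sqrt ((Real.sqrt (torusBand (2 * k) p ^ 2 + M ^ 2) + |μ'|) ^ 2 + (2 * Real.sqrt 2 * h * dWaveGap p) ^ 2)) *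
            ((torusBand (2 * k) p - μ') / 2 - μ' / (2 * |μ'| * Real.sqrt (torusBand (2 * k) p ^ 2 + M ^ 2)) *
              (torusBand (2 * k) p ^ 2 + M ^ 2 - torusBand (2 * k) p * μ')) +
          Real.tanh (β * Real.sqrt ((Real.sqrt (torusBand (2 * k) p ^ 2 + M ^ 2) - |μ'|) ^ 2 + (2 * Real.sqrt 2 * h * dWaveGap p) ^ 2) / 2) /
              (2 * Real.sqrt ((Real.sqrt (torusBand (2 * k) p ^ 2 + M ^ 2) - |μ'|) ^ 2 + (2 * Real.sqrt 2 * h * dWaveGap p) ^ 2)) *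
            ((torusBand (2 * k) p - μ') / 2 + μ' / (2 * |μ'| * Real.sqrt (torusBand (2 * k) p ^ 2 + M ^ 2)) *
              (torusBand (2 * k) p ^ 2 + M ^ 2 - torusBand (2 * k) p * μ')) : ℝ) : ℂ) • planeWave p 1 +
      ((μ' / (2 * |μ'| * Real.sqrt (torusBand (2 * k) p ^ 2 + M ^ 2)) * M * (2 * Real.sqrt 2 * h * dWaveGap p) *
          (Real.tanh (β * Real.sqrt ((Real.sqrt (torusBand (2 * k) p ^ 2 + M ^ 2) + |μ'|) ^ 2 + (2 * Real.sqrt 2 * h * dWaveGap p) ^ 2) / 2) /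
              (2 * Real.sqrt ((Real.sqrt (torusBand (2 * k) p ^ 2 + M ^ 2) + |μ'|) ^ 2 + (2 * Real.sqrt 2 * h * dWaveGap p) ^ 2)) -
            Real.tanh (β * Real.sqrt ((Real.sqrt (torusBand (2 * k) p ^ 2 + M ^ 2) - |μ'|) ^ 2 + (2 * Real.sqrt 2 * h * dWaveGap p) ^ 2) / 2) /
              (2 * Real.sqrt ((Real.sqrt (torusBand (2 * k) p ^ 2 + M ^ 2) - |μ'|) ^ 2 + (2 * Real.sqrt 2 * h * dWaveGap p) ^ 2))) : ℝ) : ℂ) •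
        planeWave (p + neelIndex (2 * k)) 0 +
      ((-M *
          (Real.tanh (β * Real.sqrt ((Real.sqrt (torusBand (2 * k) p ^ 2 + M ^ 2) + |μ'|) ^ 2 + (2 * Real.sqrt 2 * h * dWaveGap p) ^ 2) / 2) /
              (2 * Real.sqrt ((Real.sqrt (torusBand (2 * k) p ^ 2 + M ^ 2) + |μ'|) ^ 2 + (2 * Real.sqrt 2 * h * dWaveGap p) ^ 2)) *
            (1 / 2 + μ' / (2 * |μ'| * Real.sqrt (torusBand (2 * k) p ^ 2 + M ^ 2)) * μ') +
          Real.tanh (β * Real.sqrt ((Real.sqrt (torusBand (2 * k) p ^ 2 + M ^ 2) - |μ'|) ^ 2 + (2 * Real.sqrt 2 * h * dWaveGap p) ^ 2) / 2) /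
              (2 * Real.sqrt ((Real.sqrt (torusBand (2 * k) p ^ 2 + M ^ 2) - |μ'|) ^ 2 + (2 * Real.sqrt 2 * h * dWaveGap p) ^ 2)) *
            (1 / 2 - μ' / (2 * |μ'| * Real.sqrt (torusBand (2 * k) p ^ 2 + M ^ 2)) * μ')) : ℝ) : ℂ) •
        planeWave (p + neelIndex (2 * k)) 1 := by
  have hHerm := isHermitian_dWaveNambu_add_spinField (2 * k) μ' h (fun x => M * neelSign x.toTorusSite)
  have hv := afNambu_sq_mulVec_planeWave_one k hL μ' h M p
  have hw := afNambu_sq_mulVec_planeWave_neel_one k hL μ' h M p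
  have hdet : (2 * μ' * M) ^ 2 ≤ ((torusBand (2 * k) p - μ') ^ 2 + (2 * Real.sqrt 2 * h * dWaveGap p) ^ 2 + M ^ 2) *
      ((-torusBand (2 * k) p - μ') ^ 2 + (2 * Real.sqrt 2 * h * dWaveGap p) ^ 2 + M ^ 2) := by
    have h' := af_sq_block_det_nonneg (torusBand (2 * k) p) μ' (2 * Real.sqrt 2 * h * dWaveGap p) M
    rwa [neg_sq] at h'
  have key := fermi_mulVec_of_sq_pair hHerm β hv hw
    (af_sq_block_sum_nonneg (torusBand (2 * k) p) μ' (2 * Real.sqrt 2 * h * dWaveGap p) M) hdet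
  rw [af_sq_block_disc_hole, af_sq_block_eigen_plus, af_sq_block_eigen_minus, af_sq_block_sqrt_disc,
    af_sq_block_mean] at key
  rw [key, hv]
  simp only [Matrix.mulVec_add, Matrix.mulVec_sub, Matrix.mulVec_smul,
    afNambu_mulVec_planeWave_one k hL μ' h M p, afNambu_mulVec_planeWave_one k hL μ' h M (p + neelIndex (2 * k)),
    torusBand_add_neelIndex, dWaveGap_add_neelIndex, add_neelIndex_add_neelIndex]
  ext o
  simp only [Pi.add_apply, Pi.sub_apply, Pi.smul_apply, smul_eq_mul]
  push_cast
  ring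

end AFFermi

end Summit.Ventures.CertifiedManyBodySolver.Observables

end
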